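import Summits.QuantumFields.BalabanUV.Beta.FP.StepLawWardGeneric
import Summits.QuantumFields.BalabanUV.Beta.FP.RoadEndLeft
import Summits.QuantumFields.BalabanUV.Beta.FP.PerfectJetLetters

/-!
# `BalabanUV.Beta.FP.StepLawLeft` — road «FP» for binder row D1, R-FP-40 (C) (owner, gen 10): THE STEP DOOR OF THE LEFT-PLACEMENT CHAIN IS ALREADY TYPED —
# the `hstep` binder of `RoadLeftAssembly.d1Drift_left_of_sliceLedger` FOLLOWS BY NAME from this lineage's gen-3 `StepLawWardGeneric.fPerfG_succ_of_ward_symm_explicitDefect`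
# at the standard resolvent families, with the K-side class data DISCHARGED (`exists_decays_KPerf_holds`): residual {jet class data, `hWf`, `hTsymm`, `hSDF`}

HONEST DEPENDENCY (page 1, mandatory): continuum YM on T⁴ ⇐ BetaPertH ∧ nine spine estimates (0/9 proved); BetaPertH ⇐ (D1) ∧ (D4) ∧ CAP+tail;
G-an2-4 gates asym, D1 and NE2/3/4.  HONEST FRAMING (cell contract, verbatim): «discharging `BetaPertH` makes Bałaban's UV stability UNCONDITIONAL —
a real constructive-QFT result; it is NOT the continuum limit and NOT the Clay problem.»  THIS MODULE is [our object] COMPOSITION BY NAME (one call per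
theorem); no `def`, no `def … : Prop`, nothing cited, 0 sorry.  The Ward row `hWf` of the flipped perfect one-step kernel, its transposition symmetry `hTsymm`, the
vanishing `(μ,ν)` second moment `hSDF` of the EXPLICIT fixed-point defect (the shared crux STEP∕SDF content) and the class data of the literal's perfect jets are
HYPOTHESIS SHAPES, asserted for no object of Bałaban's.  0∕4 row-D1 binders; NOT STEP, NOT SDF, NOT (ASYMP), NOT D1, NOT BetaPertH, NOT continuum, NOT Clay.
«not in print; our bookkeeping».

ABSOLUTE RULE (cell charter, verbatim): «No internally-minted statement may enter as a cited fact. Every hypothesis is either kernel-proved in this package or a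
verbatim quotation of a PUBLISHED theorem with page reference. The manuscript(s) under audit are NOT citable for their own disputed steps — they are the thing
under adjudication; programme-internal (2001/route/tribunal) claims are never citable.»

WHY.  `RoadLeftAssembly.d1Drift_left_of_sliceLedger` displays STEP as ONE binder on `fPerfG Lc (sfStep Lc) (smStep 3 Lc) std std S Wt μ ν`
(`std := (j, m) ↦ KTot (Lc^(j+m)) (Lc^j)`; `KPerfOf … std m = KPerf … m` and `TGenOf n A K S W = hessKer A (vertexOfK K n S) W` by `rfl`).  The four-slot STEP
theorem of gen 3 covers exactly this family; here it is written out at the LEFT objects so that the residual of the whole chain reads, letter by letter: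
(CONV-C) S∕W rows · {jet class data per `m`, `hWf`, `hTsymm`, `hSDF`} · W-split #14 · PART 3b's 13 classes.

CONTENT.
* [our object] **`stepLaw_left_of_ward_symm_explicitDefect`** (`d = 3`, `2 ≤ Lc`, adopted units): class data of `SPerfOf … m` ∕ `WPerfOf … m` (`m ≥ 1`), `hWf`,
  `hTsymm`, `hSDF` (explicit defect against the UNDRESSED perfect column `colOf (KPerf m)`) ⊢ the `hstep` binder of `RoadLeftAssembly` VERBATIM.
* [our object] **`stepLaw_left_of_rows_ward_symm_explicitDefect`** — the same with the jet class data supplied from finite-`j` ROWS by `PerfectJetLetters`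
  (`locStencil_sPerf_of_rows`) for the stencils and asym1's `vertexFamily₂_limTabOf` for the tables.
Provenance: road FP OWNER b2b-balaban-beta-d1-p3 gen 10 (prover-b2b-balaban-beta-d1-p3-g10-0), 2026-08-21, R-FP-40 (C).
-/

noncomputable section

namespace Summit.QuantumFields.BalabanUV.Beta.FP.StepLawLeft

open Literature.MathematicalPhysics.QuantumFieldTheory.Balaban1983to89
open Literature.MathematicalPhysics.QuantumFieldTheory.Balaban1983to89.Beta
open B12Beta (secondMoment)
open DressedMomentNormalisation (dressedEntry)
open ExpKernelCalculus (MKer Decays VertexFamily₂ hessKer)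
open PolarizationSign (WardTransversal)
open OneStepResolventKernel (Fib LocStencil)
open OneStepKernelFamily (vertexOfK flipK)
open HessKerDressedLimit (vertexFamily₂_limTabOf)
open Summit.QuantumFields.BalabanUV.Beta.HessKerDressedUnits (unitS unitW)
open Summit.QuantumFields.BalabanUV.Beta.GAN24.CombesThomas (sfStep smStep)
open Summit.QuantumFields.BalabanUV.Beta.FP.PerfectObjects (KTot)
open Summit.QuantumFields.BalabanUV.Beta.FP.PerfectObjectsT (KPerf SPerfOf WPerfOf)
open Summit.QuantumFields.BalabanUV.Beta.FP.TransportInfinityM (colOf)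
open Summit.QuantumFields.BalabanUV.Beta.FP.StepDefectInherit (defect)
open Summit.QuantumFields.BalabanUV.Beta.FP.RoadEndGeneric (fPerfG)
open Summit.QuantumFields.BalabanUV.Beta.FP.StepLawKHolds (exists_decays_KPerf_holds)
open Summit.QuantumFields.BalabanUV.Beta.FP.StepLawWardGeneric (fPerfG_succ_of_ward_symm_explicitDefect)
open Summit.QuantumFields.BalabanUV.Beta.FP.PerfectJetLetters (locStencil_sPerf_of_rows)

variable {Lc : ℕ} [NeZero Lc]
  (S : ℕ → ℕ → Fin (3 + 1) → (Fin (3 + 1) → ℤ) → MKer (3 + 1) (Fib 3))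
  (Wt : ℕ → ℕ → Fin (3 + 1) → (Fin (3 + 1) → ℤ) → Fin (3 + 1) → (Fin (3 + 1) → ℤ) → MKer (3 + 1) (Fib 3))

/-- **THE STEP LAW OF THE LEFT PERFECT FAMILY, K-SIDE UNCONDITIONAL** [our object] (`d = 3`, `2 ≤ Lc`, adopted units `(sfStep Lc, smStep 3 Lc)`).  Write
`T^s_m := hessKer (KPerf m) (vertexOfK (KPerf m) (Lc^m) (SPerfOf S m)) (WPerfOf Wt m)`.  DISPLAYED: class data of the perfect stencils (`LocStencil`, some constant,
positive rate) and tables (`VertexFamily₂` at blocking `Lc^m`) for every `m ≥ 1`; the Ward row `hWf : WardTransversal (flipK T^s_1)`; the transposition symmetry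
`hTsymm : T^s_1 a b t = T^s_1 b a (−t)`; `hSDF`: the EXPLICIT fixed-point defect `T^s_{m+1} − (Lc^m)⁸·dressedEntry (colOf (KPerf m)) T^s_1 ((Lc^m)•·) − T^s_m` has zero
`(μ,ν)` second moment (the shared crux SDF).  NOT displayed: the class data of the resolvents `KPerf m` (`StepLawKHolds.exists_decays_KPerf_holds`), the column's
Kronecker rows (inside gen 3's theorem).  CONCLUSION: the `hstep` binder of `RoadLeftAssembly.d1Drift_left_of_sliceLedger` ∕ `RoadEndLeft.d1Drift_left_of_step_law_*`
VERBATIM.  One call of `StepLawWardGeneric.fPerfG_succ_of_ward_symm_explicitDefect` at `A = G := (j, m) ↦ KTot (Lc^(j+m)) (Lc^j)`. -/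
theorem stepLaw_left_of_ward_symm_explicitDefect (hLc : 2 ≤ Lc)
    (hSinf : ∀ m : ℕ, 1 ≤ m → ∃ Cs δS : ℝ, 0 < δS ∧ LocStencil (SPerfOf (sfStep Lc) (smStep 3 Lc) S m) Cs δS)
    (hWinf : ∀ m : ℕ, 1 ≤ m → ∃ Cw δW : ℝ, 0 < δW ∧ VertexFamily₂ (WPerfOf (sfStep Lc) (smStep 3 Lc) Wt m) (Lc ^ m) Cw δW)
    (hWf : WardTransversal (flipK (hessKer (KPerf (d := 3) Lc (sfStep Lc) (smStep 3 Lc) 1)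
      (vertexOfK (KPerf (d := 3) Lc (sfStep Lc) (smStep 3 Lc) 1) Lc (SPerfOf (sfStep Lc) (smStep 3 Lc) S 1)) (WPerfOf (sfStep Lc) (smStep 3 Lc) Wt 1))))
    (hTsymm : ∀ a b t, hessKer (KPerf (d := 3) Lc (sfStep Lc) (smStep 3 Lc) 1)
        (vertexOfK (KPerf (d := 3) Lc (sfStep Lc) (smStep 3 Lc) 1) Lc (SPerfOf (sfStep Lc) (smStep 3 Lc) S 1)) (WPerfOf (sfStep Lc) (smStep 3 Lc) Wt 1) a b t =
      hessKer (KPerf (d := 3) Lc (sfStep Lc) (smStep 3 Lc) 1)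
        (vertexOfK (KPerf (d := 3) Lc (sfStep Lc) (smStep 3 Lc) 1) Lc (SPerfOf (sfStep Lc) (smStep 3 Lc) S 1)) (WPerfOf (sfStep Lc) (smStep 3 Lc) Wt 1) b a (-t))
    (μ ν : Fin 4)
    (hSDF : ∀ m : ℕ, 1 ≤ m → secondMoment (defect
      (fun m => hessKer (KPerf (d := 3) Lc (sfStep Lc) (smStep 3 Lc) m)
        (vertexOfK (KPerf (d := 3) Lc (sfStep Lc) (smStep 3 Lc) m) (Lc ^ m) (SPerfOf (sfStep Lc) (smStep 3 Lc) S m)) (WPerfOf (sfStep Lc) (smStep 3 Lc) Wt m))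
      (fun m a b z => ((Lc ^ m : ℕ) : ℝ) ^ 8 * dressedEntry (colOf (KPerf (d := 3) Lc (sfStep Lc) (smStep 3 Lc) m))
        (hessKer (KPerf (d := 3) Lc (sfStep Lc) (smStep 3 Lc) 1)
          (vertexOfK (KPerf (d := 3) Lc (sfStep Lc) (smStep 3 Lc) 1) Lc (SPerfOf (sfStep Lc) (smStep 3 Lc) S 1)) (WPerfOf (sfStep Lc) (smStep 3 Lc) Wt 1))
        (((Lc ^ m : ℕ) : ℤ) • z) a b) m) μ ν = 0) :
    ∀ m : ℕ, 1 ≤ m →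
      fPerfG Lc (sfStep Lc) (smStep 3 Lc) (fun j m => KTot (d := 3) (Lc ^ (j + m)) (Lc ^ j)) (fun j m => KTot (d := 3) (Lc ^ (j + m)) (Lc ^ j))
          S Wt μ ν (m + 1) =
        fPerfG Lc (sfStep Lc) (smStep 3 Lc) (fun j m => KTot (d := 3) (Lc ^ (j + m)) (Lc ^ j)) (fun j m => KTot (d := 3) (Lc ^ (j + m)) (Lc ^ j))
            S Wt μ ν m +
          fPerfG Lc (sfStep Lc) (smStep 3 Lc) (fun j m => KTot (d := 3) (Lc ^ (j + m)) (Lc ^ j)) (fun j m => KTot (d := 3) (Lc ^ (j + m)) (Lc ^ j))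
            S Wt μ ν 1 := by
  have hKinf : ∀ m : ℕ, 1 ≤ m → ∃ δ C : ℝ, 0 < δ ∧ 0 ≤ C ∧ Decays (KPerf (d := 3) Lc (sfStep Lc) (smStep 3 Lc) m) C δ := fun m hm => by
    obtain ⟨C, δ, hδ, hK⟩ := exists_decays_KPerf_holds hLc hm
    exact ⟨δ, C, hδ, hK.nonneg (Sum.inl 0), hK⟩
  exact fPerfG_succ_of_ward_symm_explicitDefect (sfStep Lc) (smStep 3 Lc) (fun j m => KTot (d := 3) (Lc ^ (j + m)) (Lc ^ j))
    (fun j m => KTot (d := 3) (Lc ^ (j + m)) (Lc ^ j)) S Wt hLc hKinf hKinf hSinf hWinf hWf hTsymm μ ν hSDF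

/-- **THE SAME, WITH THE JET CLASS DATA FROM FINITE-`j` ROWS** [our object]: for every `m ≥ 1`, uniform `LocStencil` rows + all-scales deviations (`θ m < 1`,
`δs m > 0`) of the unit-rescaled (j, m)-stencils (X1m-S) and uniform `VertexFamily₂` rows at blocking `Lc^m` + deviations (`δw m > 0`) of the unit-rescaled
(j, m)-tables (X1m-W) REPLACE the class data of the perfect jets (`PerfectJetLetters.locStencil_sPerf_of_rows`, asym1's `vertexFamily₂_limTabOf`); `hWf`, `hTsymm`,
`hSDF` as above ⊢ the `hstep` binder. -/
theorem stepLaw_left_of_rows_ward_symm_explicitDefect (hLc : 2 ≤ Lc) {Cs cS δs θS Cw cW δw θW : ℕ → ℝ}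
    (hS : ∀ m : ℕ, 1 ≤ m → ∀ j, LocStencil (unitS (sfStep Lc j) (smStep 3 Lc j) (S j m)) (Cs m) (δs m))
    (hSall : ∀ m : ℕ, 1 ≤ m → ∀ k j,
      LocStencil (unitS (sfStep Lc (k + j)) (smStep 3 Lc (k + j)) (S (k + j) m) - unitS (sfStep Lc k) (smStep 3 Lc k) (S k m)) (cS m * θS m ^ k) (δs m))
    (hθS : ∀ m : ℕ, 1 ≤ m → θS m < 1) (hδs : ∀ m : ℕ, 1 ≤ m → 0 < δs m)
    (hW : ∀ m : ℕ, 1 ≤ m → ∀ j, VertexFamily₂ (unitW (sfStep Lc j) (smStep 3 Lc j) (Wt j m)) (Lc ^ m) (Cw m) (δw m))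
    (hWall : ∀ m : ℕ, 1 ≤ m → ∀ k j,
      VertexFamily₂ (unitW (sfStep Lc (k + j)) (smStep 3 Lc (k + j)) (Wt (k + j) m) - unitW (sfStep Lc k) (smStep 3 Lc k) (Wt k m)) (Lc ^ m)
        (cW m * θW m ^ k) (δw m))
    (hθW : ∀ m : ℕ, 1 ≤ m → θW m < 1) (hδw : ∀ m : ℕ, 1 ≤ m → 0 < δw m)
    (hWf : WardTransversal (flipK (hessKer (KPerf (d := 3) Lc (sfStep Lc) (smStep 3 Lc) 1)
      (vertexOfK (KPerf (d := 3) Lc (sfStep Lc) (smStep 3 Lc) 1) Lc (SPerfOf (sfStep Lc) (smStep 3 Lc) S 1)) (WPerfOf (sfStep Lc) (smStep 3 Lc) Wt 1))))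
    (hTsymm : ∀ a b t, hessKer (KPerf (d := 3) Lc (sfStep Lc) (smStep 3 Lc) 1)
        (vertexOfK (KPerf (d := 3) Lc (sfStep Lc) (smStep 3 Lc) 1) Lc (SPerfOf (sfStep Lc) (smStep 3 Lc) S 1)) (WPerfOf (sfStep Lc) (smStep 3 Lc) Wt 1) a b t =
      hessKer (KPerf (d := 3) Lc (sfStep Lc) (smStep 3 Lc) 1)
        (vertexOfK (KPerf (d := 3) Lc (sfStep Lc) (smStep 3 Lc) 1) Lc (SPerfOf (sfStep Lc) (smStep 3 Lc) S 1)) (WPerfOf (sfStep Lc) (smStep 3 Lc) Wt 1) b a (-t))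
    (μ ν : Fin 4)
    (hSDF : ∀ m : ℕ, 1 ≤ m → secondMoment (defect
      (fun m => hessKer (KPerf (d := 3) Lc (sfStep Lc) (smStep 3 Lc) m)
        (vertexOfK (KPerf (d := 3) Lc (sfStep Lc) (smStep 3 Lc) m) (Lc ^ m) (SPerfOf (sfStep Lc) (smStep 3 Lc) S m)) (WPerfOf (sfStep Lc) (smStep 3 Lc) Wt m))
      (fun m a b z => ((Lc ^ m : ℕ) : ℝ) ^ 8 * dressedEntry (colOf (KPerf (d := 3) Lc (sfStep Lc) (smStep 3 Lc) m))
        (hessKer (KPerf (d := 3) Lc (sfStep Lc) (smStep 3 Lc) 1)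
          (vertexOfK (KPerf (d := 3) Lc (sfStep Lc) (smStep 3 Lc) 1) Lc (SPerfOf (sfStep Lc) (smStep 3 Lc) S 1)) (WPerfOf (sfStep Lc) (smStep 3 Lc) Wt 1))
        (((Lc ^ m : ℕ) : ℤ) • z) a b) m) μ ν = 0) :
    ∀ m : ℕ, 1 ≤ m →
      fPerfG Lc (sfStep Lc) (smStep 3 Lc) (fun j m => KTot (d := 3) (Lc ^ (j + m)) (Lc ^ j)) (fun j m => KTot (d := 3) (Lc ^ (j + m)) (Lc ^ j))
          S Wt μ ν (m + 1) =
        fPerfG Lc (sfStep Lc) (smStep 3 Lc) (fun j m => KTot (d := 3) (Lc ^ (j + m)) (Lc ^ j)) (fun j m => KTot (d := 3) (Lc ^ (j + m)) (Lc ^ j))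
            S Wt μ ν m +
          fPerfG Lc (sfStep Lc) (smStep 3 Lc) (fun j m => KTot (d := 3) (Lc ^ (j + m)) (Lc ^ j)) (fun j m => KTot (d := 3) (Lc ^ (j + m)) (Lc ^ j))
            S Wt μ ν 1 :=
  stepLaw_left_of_ward_symm_explicitDefect S Wt hLc
    (fun m hm => ⟨Cs m, δs m, hδs m hm, locStencil_sPerf_of_rows (sfStep Lc) (smStep 3 Lc) S m (hS m hm) (hSall m hm) (hθS m hm)⟩)
    (fun m hm => ⟨Cw m, δw m, hδw m hm,
      vertexFamily₂_limTabOf (W := fun j => unitW (sfStep Lc j) (smStep 3 Lc j) (Wt j m)) (hW m hm) (hWall m hm) (hθW m hm)⟩)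
    hWf hTsymm μ ν hSDF

end Summit.QuantumFields.BalabanUV.Beta.FP.StepLawLeft

end
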